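import Literature.AlgebraicGeometry.Frobenioids.BaseSectionsOfObjectsCor57bProofs
import Literature.AlgebraicGeometry.Frobenioids.EquivalenceThm34Assembly
import Literature.AlgebraicGeometry.Frobenioids.EquivalencePreStepsQuasiIsotropic
import HarnessLib

/-!
# Frobenioids I, Corollary 5.7 (Category-theoreticity of Base-Sections) over bases of FSM-type:
# the Theorem 3.4 inputs DISCHARGED — (i), (iii), (iv) conditional only on Corollary 4.11 (ii)

Mochizuki, *The geometry of Frobenioids I: the general theory*, Kyushu J. Math. **62** (2008)
293–400, Cor. 5.7 (i)–(iv) pp. 107–108, proof p. 108 ll. 15–21 [cite: MochizukiFrdI2008, Cor. 5.7 p.107]: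
"it suffices to show that `Ψ` preserves isotropic objects, prime-Frobenius morphisms, pull-back morphisms,
birationalizations, the natural projection functor `C_i → D_i` …, and … Frobenius degrees. But this follows
from Theorem 3.4, (i), (iii); Corollary 4.10; Corollary 4.11, (ii)."

PROOF-ONLY file (abc-iut cell, seat abc-iut-w4-d086; row W4 of `plan/L1/DISCHARGE-L1.md` §0: "the four
clauses are proved UNDER named hypotheses: cut the hypotheses themselves … so the conditionals become
unconditional"). The landed proofs of Cor. 5.7 (abc-iut-L1-d6, `BaseSectionsOfObjectsCor57Proofs.lean` /
`…Cor57bProofs.lean`) take as hypotheses the typed per-instance statements of [FrdI] Thm. 3.4 (ii), (iii)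
and Cor. 4.11 (ii) for `Ψ` (and `Ψ⁻¹`). This file DISCHARGES the Theorem 3.4 inputs over bases of
FSM-type (the cell's repaired base hypothesis, under which the typed Thm. 3.4 (ii) and (iii) are theorems:
abc-iut-L1-t13's `FrdI.thm34ii_of_isOfFSMType`, abc-iut-w4-d033's `FrdI.thm34iii_ofFunctor_of_isOfFSMType`),
leaving Cor. 5.7 (i), (iii), (iv) conditional ONLY on the typed per-instance Cor. 4.11 (ii)
(`PreFrobenioidData.Cor411ii`, the apex of the sub-DAG `plan/L1/SUBDAG-FrdI-Cor411.md`), exactly as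
Cor. 5.7 (ii) already was (`PreFrobenioid.cor57ii_of_cor411ii`). The W4 cut is thus: row A = Thm. 3.4 (iii)
instance [CLOSED here], row B = Cor. 4.11 (ii) instance [the Cor411 sub-DAG], row C = Thm. 3.4 (ii) instances
for `Ψ`, `Ψ⁻¹` [CLOSED here]. Nothing here is specific to the abc programme; no statement of the paper is
restated or strengthened; nothing bears on [IUTchIII] Cor. 3.12.
-/

namespace Literature.AlgebraicGeometry.Frobenioids

open CategoryTheory Opposite

universe w v v' u u'

namespace PreFrobenioid

section Cor57FSM

variable {D₁ : Type u} [Category.{v} D₁] {Φ₁ : D₁ᵒᵖ ⥤ CommMonCat.{w}}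
  {C₁ : Type u'} [Category.{v'} C₁] (F₁ : C₁ ⥤ ElemFrobenioid Φ₁)
  {D₂ : Type u} [Category.{v} D₂] {Φ₂ : D₂ᵒᵖ ⥤ CommMonCat.{w}}
  {C₂ : Type u'} [Category.{v'} C₂] (F₂ : C₂ ⥤ ElemFrobenioid Φ₂) (Ψ : C₁ ≌ C₂)

/-- Row C of the W4 cut: over bases of FSM-type the typed per-instance [FrdI] Thm. 3.4 (ii) holds for every
pair of Frobenioids (abc-iut-L1-t13's `FrdI.thm34ii_of_isOfFSMType`; the FSMFF hypotheses of the typed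
statement are then not needed). [cite: MochizukiFrdI2008, Thm. 3.4 (ii) p.62] -/
theorem thm34ii_inst_of_isOfFSMType (hF₁ : IsFrobenioid F₁) (hF₂ : IsFrobenioid F₂) (hD₁ : IsOfFSMType D₁)
    (hD₂ : IsOfFSMType D₂) :
    (PreFrobenioidData.ofFunctor Φ₁ F₁).Thm34ii (PreFrobenioidData.ofFunctor Φ₂ F₂) Ψ :=
  fun hq₁ hq₂ _ _ => FrdI.thm34ii_of_isOfFSMType hF₁ hF₂ hq₁ hq₂ hD₁ hD₂ Ψ

/-- **Corollary 5.7 (i), base-sections, over FSM-type bases** — conditional only on the typed Cor. 4.11 (ii)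
for `Ψ`: `Ψ` maps every base-section of `C₁` into a base-section of `C₂` (the Thm. 3.4 (iii) input of
`cor57i_sections_of` is abc-iut-w4-d033's `FrdI.thm34iii_ofFunctor_of_isOfFSMType`).
[cite: MochizukiFrdI2008, Cor. 5.7 (i) p.107] -/
theorem cor57i_sections_of_isOfFSMType (hD₁ : IsOfFSMType D₁) (hD₂ : IsOfFSMType D₂)
    (h411 : (PreFrobenioidData.ofFunctor Φ₁ F₁).Cor411ii (PreFrobenioidData.ofFunctor Φ₂ F₂) Ψ) :
    Cor57i_sections F₁ F₂ Ψ := fun hyp =>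
  cor57i_sections_of F₁ F₂ Ψ
    (FrdI.thm34iii_ofFunctor_of_isOfFSMType hyp.isFrobenioid₁ hyp.isFrobenioid₂ hD₁ hD₂ Ψ) h411 hyp

/-- **Corollary 5.7 (i), quasi-base-Frobenius pairs, over FSM-type bases** — conditional only on the typed
Cor. 4.11 (ii) for `Ψ`. [cite: MochizukiFrdI2008, Cor. 5.7 (i) p.107] -/
theorem cor57i_pairs_of_isOfFSMType (hD₁ : IsOfFSMType D₁) (hD₂ : IsOfFSMType D₂)
    (h411 : (PreFrobenioidData.ofFunctor Φ₁ F₁).Cor411ii (PreFrobenioidData.ofFunctor Φ₂ F₂) Ψ) :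
    Cor57i_pairs F₁ F₂ Ψ := fun hyp =>
  cor57i_pairs_of F₁ F₂ Ψ
    (FrdI.thm34iii_ofFunctor_of_isOfFSMType hyp.isFrobenioid₁ hyp.isFrobenioid₂ hD₁ hD₂ Ψ) h411 hyp

/-- **Corollary 5.7 (i), "in particular, `C₁` is of model type iff `C₂` is" (pre-model half), over FSM-type
bases** — conditional only on the typed Cor. 4.11 (ii) for `Ψ` and for `Ψ⁻¹`.
[cite: MochizukiFrdI2008, Cor. 5.7 (i) p.107] -/
theorem isOfPreModelType_iff_of_isOfFSMType (hD₁ : IsOfFSMType D₁) (hD₂ : IsOfFSMType D₂)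
    (h411 : (PreFrobenioidData.ofFunctor Φ₁ F₁).Cor411ii (PreFrobenioidData.ofFunctor Φ₂ F₂) Ψ)
    (h411' : (PreFrobenioidData.ofFunctor Φ₂ F₂).Cor411ii (PreFrobenioidData.ofFunctor Φ₁ F₁) Ψ.symm)
    (hyp : Cor57Hypotheses F₁ F₂ Ψ) : IsOfPreModelType F₁ ↔ IsOfPreModelType F₂ :=
  isOfPreModelType_iff_of F₁ F₂ Ψ
    (FrdI.thm34iii_ofFunctor_of_isOfFSMType hyp.isFrobenioid₁ hyp.isFrobenioid₂ hD₁ hD₂ Ψ) h411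
    (FrdI.thm34iii_ofFunctor_of_isOfFSMType hyp.isFrobenioid₂ hyp.isFrobenioid₁ hD₂ hD₁ Ψ.symm) h411' hyp

/-- **Corollary 5.7 (iii) over FSM-type bases** — conditional only on the typed Cor. 4.11 (ii) for `Ψ`: for
`C₁`, `C₂` of model and unit-profinite type, `Ψ` maps every quasi-base-Frobenius pair of a Frobenius-trivial
object to one of its (Frobenius-trivial) image. [cite: MochizukiFrdI2008, Cor. 5.7 (iii) p.108] -/
theorem cor57iii_of_isOfFSMType (B₁ : (PreFrobenioidData.ofFunctor Φ₁ F₁).BiratData)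
    (B₂ : (PreFrobenioidData.ofFunctor Φ₂ F₂).BiratData) (hD₁ : IsOfFSMType D₁) (hD₂ : IsOfFSMType D₂)
    (h411 : (PreFrobenioidData.ofFunctor Φ₁ F₁).Cor411ii (PreFrobenioidData.ofFunctor Φ₂ F₂) Ψ) :
    Cor57iii F₁ F₂ Ψ B₁ B₂ := fun hyp =>
  cor57iii_of F₁ F₂ Ψ B₁ B₂
    (FrdI.thm34iii_ofFunctor_of_isOfFSMType hyp.isFrobenioid₁ hyp.isFrobenioid₂ hD₁ hD₂ Ψ) h411 hyp

/-- **Corollary 5.7 (iv) over FSM-type bases** — conditional only on the typed Cor. 4.11 (ii) for `Ψ`: in the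
situation of (iii), if `Ψ` preserves Frobenius degrees, then "quasi-" may be removed (the Thm. 3.4 (ii)
inputs for `Ψ`, `Ψ⁻¹` and the Thm. 3.4 (iii) input are theorems over FSM-type bases).
[cite: MochizukiFrdI2008, Cor. 5.7 (iv) p.108] -/
theorem cor57iv_of_isOfFSMType (B₁ : (PreFrobenioidData.ofFunctor Φ₁ F₁).BiratData)
    (B₂ : (PreFrobenioidData.ofFunctor Φ₂ F₂).BiratData) (hD₁ : IsOfFSMType D₁) (hD₂ : IsOfFSMType D₂)
    (h411 : (PreFrobenioidData.ofFunctor Φ₁ F₁).Cor411ii (PreFrobenioidData.ofFunctor Φ₂ F₂) Ψ) :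
    Cor57iv F₁ F₂ Ψ B₁ B₂ := fun hyp =>
  cor57iv_of F₁ F₂ Ψ B₁ B₂
    (thm34ii_inst_of_isOfFSMType F₁ F₂ Ψ hyp.isFrobenioid₁ hyp.isFrobenioid₂ hD₁ hD₂)
    (thm34ii_inst_of_isOfFSMType F₂ F₁ Ψ.symm hyp.isFrobenioid₂ hyp.isFrobenioid₁ hD₂ hD₁)
    (FrdI.thm34iii_ofFunctor_of_isOfFSMType hyp.isFrobenioid₁ hyp.isFrobenioid₂ hD₁ hD₂ Ψ) h411 hyp

end Cor57FSM

end PreFrobenioid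

end Literature.AlgebraicGeometry.Frobenioids
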